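import Mathlib
import HarnessLib
import Summits.NavierStokesRegularity.NavierStokesRegularity.Theorems.PoloidalWindowDoorLrcModEntireMorseLevelRays

/-!
# Route `PoloidalWindowDoor`, crux `PoloidalWindowRigidity` (stmt-19708) / item `LrcModEntire` (stmt-20428), ideator line `thread_axis`
# (ns-idea-8) — stub S7′-M `stub_morseLevelPackage`, helper IV: ELEMENTARY GEOMETRY OF THE VERTICAL AXIS AND THE HORIZONTAL ANNULUS

Seat ns-poloidal-K2-p2 g10 (LEAD-lineage on 19708; file `--supports`).  Small facts about `ℝ³ = EuclideanSpace ℝ (Fin 3)` used by the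
assembly of the Morse package:

* `vproj_*` — the vertical projection `o = (p₂) • e₂` of a point `p`: components, norm `|p₂| ≤ ‖p‖`, `‖p − o‖ ≤ ‖p‖`, `(p − o)₂ = 0`;
* `norm_smul_unit_horizontal`, `mem_closedBall_axis_add` — `‖o + t•e‖ ≤ ‖o‖ + t` for unit `e`, `t ≥ 0`;
* `isCompact_horizontalAnnulus`, `exists_max_horizontalAnnulus_lt` — the horizontal annulus `{x | x₂ = 0, a ≤ ‖x‖ ≤ b}` is compact and, for a
  `C²` function with a critical point at `0` that is strictly concave along horizontal rays inside `B̄(0,δ)` (`b ≤ δ`), the maximum of `g`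
  over it is `< g 0` (helper I `ray_strictAnti_of_deriv_zero`).

WHAT THIS IS NOT: not a claim about Navier–Stokes; Euclidean geometry (bears_on LADDER-NS N0 via crux 19708 / item 20428, thread_axis S7′-M). [folklore]
-/

noncomputable section

-- the summit and its single sub-problem share the name (CONVENTIONS §1), as in every Theorems file
set_option linter.dupNamespace false

namespace Summit.NavierStokesRegularity.NavierStokesRegularity.Theorems.PoloidalWindowDoorLrcModEntireMorseLevelGeometry

open Set Function Filter Topology Metric
open scoped RealInnerProductSpace
open Summit.NavierStokesRegularity.NavierStokesRegularity.Theorems.PoloidalWindowDoorLrcModEntireMorseLevelRays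

/-! ### The vertical projection -/

/-- Components of `h • e₂`. [folklore] -/
theorem vaxis_apply (h : ℝ) :
    (h • EuclideanSpace.single (2 : Fin 3) (1 : ℝ) : EuclideanSpace ℝ (Fin 3)) 2 = h ∧
    (h • EuclideanSpace.single (2 : Fin 3) (1 : ℝ) : EuclideanSpace ℝ (Fin 3)) 0 = 0 ∧
    (h • EuclideanSpace.single (2 : Fin 3) (1 : ℝ) : EuclideanSpace ℝ (Fin 3)) 1 = 0 := by
  refine ⟨?_, ?_, ?_⟩ <;> simp

/-- `‖h • e₂‖ = |h|`. [folklore] -/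
theorem norm_vaxis (h : ℝ) : ‖(h • EuclideanSpace.single (2 : Fin 3) (1 : ℝ) : EuclideanSpace ℝ (Fin 3))‖ = |h| := by
  rw [norm_smul, PiLp.norm_single, norm_one, mul_one, Real.norm_eq_abs]

/-- A coordinate is bounded by the norm: `|p i| ≤ ‖p‖`. [folklore] -/
theorem abs_apply_le_norm (p : EuclideanSpace ℝ (Fin 3)) (i : Fin 3) : |p i| ≤ ‖p‖ := by
  have h1 : |p i| = Real.sqrt (‖p i‖ ^ 2) := by
    rw [Real.norm_eq_abs, Real.sqrt_sq (abs_nonneg _)]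
  rw [h1, EuclideanSpace.norm_eq]
  exact Real.sqrt_le_sqrt (Finset.single_le_sum (f := fun j => ‖p j‖ ^ 2) (fun j _ => sq_nonneg _) (Finset.mem_univ i))

/-- The horizontal part `p − (p₂)•e₂` is horizontal. [folklore] -/
theorem sub_vproj_apply_two (p : EuclideanSpace ℝ (Fin 3)) :
    (p - p 2 • EuclideanSpace.single (2 : Fin 3) (1 : ℝ)) 2 = 0 := by
  simp

/-- The horizontal part is not longer than the vector: `‖p − (p₂)•e₂‖ ≤ ‖p‖`. [folklore] -/
theorem norm_sub_vproj_le (p : EuclideanSpace ℝ (Fin 3)) :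
    ‖p - p 2 • EuclideanSpace.single (2 : Fin 3) (1 : ℝ)‖ ≤ ‖p‖ := by
  rw [EuclideanSpace.norm_eq, EuclideanSpace.norm_eq]
  refine Real.sqrt_le_sqrt ?_
  rw [Fin.sum_univ_three, Fin.sum_univ_three]
  have e0 : (p - p 2 • EuclideanSpace.single (2 : Fin 3) (1 : ℝ)) 0 = p 0 := by simp
  have e1 : (p - p 2 • EuclideanSpace.single (2 : Fin 3) (1 : ℝ)) 1 = p 1 := by simp
  rw [e0, e1, sub_vproj_apply_two]
  simp only [norm_zero]
  nlinarith [sq_nonneg ‖p 2‖]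

/-- `p = (p₂)•e₂ + (p − (p₂)•e₂)`. [folklore] -/
theorem vproj_add_sub (p : EuclideanSpace ℝ (Fin 3)) :
    p 2 • EuclideanSpace.single (2 : Fin 3) (1 : ℝ) + (p - p 2 • EuclideanSpace.single (2 : Fin 3) (1 : ℝ)) = p := by
  abel

/-- `‖o + t•e‖ ≤ ‖o‖ + t` for a unit vector `e` and `t ≥ 0`; hence membership in a ball. [folklore] -/
theorem mem_closedBall_axis_add {o e : EuclideanSpace ℝ (Fin 3)} (he : ‖e‖ = 1) {t δ : ℝ} (ht : 0 ≤ t)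
    (h : ‖o‖ + t ≤ δ) : o + t • e ∈ closedBall (0 : EuclideanSpace ℝ (Fin 3)) δ := by
  rw [mem_closedBall, dist_zero_right]
  calc ‖o + t • e‖ ≤ ‖o‖ + ‖t • e‖ := norm_add_le _ _
    _ = ‖o‖ + t := by rw [norm_smul, he, mul_one, Real.norm_of_nonneg ht]
    _ ≤ δ := h

/-- The point `o + t•e` is at distance `t` from `o` (`e` unit, `t ≥ 0`). [folklore] -/
theorem dist_axis_add {o e : EuclideanSpace ℝ (Fin 3)} (he : ‖e‖ = 1) {t : ℝ} (ht : 0 ≤ t) : dist (o + t • e) o = t := by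
  rw [dist_eq_norm, add_sub_cancel_left, norm_smul, he, mul_one, Real.norm_of_nonneg ht]

/-! ### The horizontal annulus -/

/-- The horizontal annulus `{x | x₂ = 0, a ≤ ‖x‖ ≤ b}` is compact. [folklore] -/
theorem isCompact_horizontalAnnulus (a b : ℝ) :
    IsCompact {x : EuclideanSpace ℝ (Fin 3) | x 2 = 0 ∧ a ≤ ‖x‖ ∧ ‖x‖ ≤ b} := by
  have h1 : IsClosed {x : EuclideanSpace ℝ (Fin 3) | x 2 = 0} :=
    isClosed_eq (EuclideanSpace.proj (2 : Fin 3)).continuous continuous_const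
  have h2 : IsClosed {x : EuclideanSpace ℝ (Fin 3) | a ≤ ‖x‖} := isClosed_le continuous_const continuous_norm
  have h3 : IsClosed {x : EuclideanSpace ℝ (Fin 3) | ‖x‖ ≤ b} := isClosed_le continuous_norm continuous_const
  have he : {x : EuclideanSpace ℝ (Fin 3) | x 2 = 0 ∧ a ≤ ‖x‖ ∧ ‖x‖ ≤ b} = {x | x 2 = 0} ∩ ({x | a ≤ ‖x‖} ∩ {x | ‖x‖ ≤ b}) := by
    ext x; simp
  rw [he]
  refine (isCompact_closedBall (0 : EuclideanSpace ℝ (Fin 3)) b).of_isClosed_subset (h1.inter (h2.inter h3)) ?_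
  rintro x ⟨-, -, hx⟩
  exact mem_closedBall_zero_iff.2 hx

variable {g : EuclideanSpace ℝ (Fin 3) → ℝ}

/-- **Strict descent along horizontal rays from a concave critical point**: if `dg(0) = 0` and `D²g(y)(e,e) < 0` for `‖y‖ ≤ δ` and
horizontal unit `e`, then `g(t•e) < g 0` for `0 < t ≤ δ`. [folklore] -/
theorem ray_lt_of_concave (hg : ContDiff ℝ 2 g) (h0 : fderiv ℝ g 0 = 0) {δ : ℝ}
    (hconc : ∀ y ∈ closedBall (0 : EuclideanSpace ℝ (Fin 3)) δ, ∀ e : EuclideanSpace ℝ (Fin 3),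
      e 2 = 0 → ‖e‖ = 1 → fderiv ℝ (fderiv ℝ g) y e e < 0)
    {e : EuclideanSpace ℝ (Fin 3)} (he2 : e 2 = 0) (he1 : ‖e‖ = 1) {t : ℝ} (ht0 : 0 < t) (htδ : t ≤ δ) :
    g (t • e) < g 0 := by
  have hgd : Differentiable ℝ g := hg.differentiable two_ne_zero
  have hφ := fun s => hasDerivAt_ray hgd 0 e s
  have hφ' := fun s => hasDerivAt_ray_deriv hg 0 e s
  have hnegI : ∀ s ∈ Icc 0 δ, fderiv ℝ (fun x => fderiv ℝ g x e) (0 + s • e) e < 0 := by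
    intro s hs
    rw [fderiv_fderiv_apply_const hg]
    exact hconc _ (mem_closedBall_axis_add he1 hs.1 (by simpa using hs.2)) e he2 he1
  have h0' : fderiv ℝ g ((0 : EuclideanSpace ℝ (Fin 3)) + (0 : ℝ) • e) e = 0 := by simp [h0]
  have hanti := ray_strictAnti_of_deriv_zero hφ hφ' hnegI h0'
  have hδ : 0 ≤ δ := ht0.le.trans htδ
  have := hanti (left_mem_Icc.2 hδ) ⟨ht0.le, htδ⟩ ht0
  simpa using this

/-- **The maximum over the horizontal annulus is strictly below the central value.**  Under the hypotheses of `ray_lt_of_concave`,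
for `0 < a ≤ b ≤ δ` there is `x₀` in the annulus `{x | x₂ = 0, a ≤ ‖x‖ ≤ b}` with `g x ≤ g x₀ < g 0` for all `x` in the annulus. [folklore] -/
theorem exists_max_horizontalAnnulus_lt (hg : ContDiff ℝ 2 g) (h0 : fderiv ℝ g 0 = 0) {δ a b : ℝ} (ha : 0 < a) (hab : a ≤ b)
    (hb : b ≤ δ)
    (hconc : ∀ y ∈ closedBall (0 : EuclideanSpace ℝ (Fin 3)) δ, ∀ e : EuclideanSpace ℝ (Fin 3),
      e 2 = 0 → ‖e‖ = 1 → fderiv ℝ (fderiv ℝ g) y e e < 0) :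
    ∃ x₀ : EuclideanSpace ℝ (Fin 3), g x₀ < g 0 ∧
      ∀ x : EuclideanSpace ℝ (Fin 3), x 2 = 0 → a ≤ ‖x‖ → ‖x‖ ≤ b → g x ≤ g x₀ := by
  set K : Set (EuclideanSpace ℝ (Fin 3)) := {x | x 2 = 0 ∧ a ≤ ‖x‖ ∧ ‖x‖ ≤ b} with hK
  have hKc : IsCompact K := isCompact_horizontalAnnulus a b
  have hKne : K.Nonempty := by
    refine ⟨a • EuclideanSpace.single (0 : Fin 3) (1 : ℝ), ?_, ?_, ?_⟩
    · simp
    · rw [norm_smul, PiLp.norm_single, norm_one, mul_one, Real.norm_of_nonneg ha.le]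
    · rw [norm_smul, PiLp.norm_single, norm_one, mul_one, Real.norm_of_nonneg ha.le]; exact hab
  obtain ⟨x₀, hx₀K, hx₀max⟩ := hKc.exists_isMaxOn hKne hg.continuous.continuousOn
  refine ⟨x₀, ?_, fun x hx2 hxa hxb => hx₀max ⟨hx2, hxa, hxb⟩⟩
  -- `x₀ = ‖x₀‖ • e` with `e` horizontal unit
  obtain ⟨hx2, hxa, hxb⟩ := hx₀K
  have hn0 : 0 < ‖x₀‖ := ha.trans_le hxa
  set e : EuclideanSpace ℝ (Fin 3) := ‖x₀‖⁻¹ • x₀ with he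
  have he1 : ‖e‖ = 1 := by rw [he, norm_smul, norm_inv, norm_norm, inv_mul_cancel₀ hn0.ne']
  have he2 : e 2 = 0 := by rw [he]; simp [hx2]
  have hx₀e : x₀ = ‖x₀‖ • e := by rw [he, smul_smul, mul_inv_cancel₀ hn0.ne', one_smul]
  rw [hx₀e]
  exact ray_lt_of_concave hg h0 hconc he2 he1 hn0 (hxb.trans hb)

end Summit.NavierStokesRegularity.NavierStokesRegularity.Theorems.PoloidalWindowDoorLrcModEntireMorseLevelGeometry

end
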